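import Mathlib
import Literature.MathematicalPhysics.QuantumLattice.TorusShellCountUniform

/-!
# Grid refinement of the grand-canonical band sum `Σ_k min(ε_L(k) - μ, 0)`

Topic `MathematicalPhysics/QuantumLattice` (family `hubbard`). For the square-lattice torus band
`ε_L(k) = torusBand L k = -2 Σ_i cos(2π k_i/L)` on `(ℤ/Lℤ)²` and the grand-canonical free energy
sum `G_L(μ) = Σ_{k ∈ (ℤ/Lℤ)²} min(ε_L(k) - μ, 0)` (the `T = 0` grand-canonical ground energy of the
free spinless torus gas at chemical potential `μ`, cf. `groundEnergy_hubbardTorusWith_zero`), we prove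
the REFINEMENT COMPARISON, uniform in `μ`:

* `torusSite_refine_bijective` — the momenta of the torus of side `M·c` are the pairs
  `(k, r) ∈ (ℤ/Mℤ)² × [0,c)²` through `k'_i = c·k_i + r_i`;
* `abs_torusBand_refine_sub_le` — along this correspondence the band moves by at most `8π/M`
  (`|cos a - cos b| ≤ |a - b|`, `r_i/(Mc) < 1/M`);
* `abs_sq_mul_gcBandSum_sub_le` — hence **`|c² · G_M(μ) - G_{Mc}(μ)| ≤ 8π · M · c²`**, i.e. per
  site `|G_M(μ)/M² - G_{Mc}(μ)/(Mc)²| ≤ 8π/M`, for all `μ` (`t ↦ min(t - μ, 0)` is `1`-Lipschitz).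

Two grids of sides `L`, `L'` are thereby compared through their common refinement `L·L'` without
any integral: `G_{L'}(μ)/L'² ≥ G_L(μ)/L² - 8π/L - 8π/L'` (`gcBandSum_div_sq_ge_of_refine`). This is
the discrete (Riemann-sum-free) form of the convergence of the free energy density of the lattice
Fermi gas; used to compare Dirichlet BLOCK kinetic energies with the torus Fermi energy in local
kinetic-budget arguments. Folklore; no definition and no named fact is introduced.

References: D. Ruelle, *Statistical Mechanics: Rigorous Results* (1969) §2.2, §3.4 (thermodynamic
limit of free energies by comparison of boxes); tree: `torusBand`, `latticeMomentum`,
`card_torusSite`, `Real.abs_cos_sub_cos_le`.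
-/

namespace Literature.MathematicalPhysics.QuantumLattice

open Finset Literature.Probability.LatticeModels

noncomputable section

/-! ### The refinement map `(k, r) ↦ c·k + r` -/

/-- The refinement map on momenta: `(k, r) ↦ (c·k_i + r_i)_i` from `(ℤ/Mℤ)² × [0,c)²` to
`(ℤ/(Mc)ℤ)²`. [folklore] -/
theorem torusSite_refine_val (M c : ℕ) [NeZero M] [NeZero c] (k : TorusSite 2 M)
    (r : Fin 2 → Fin c) (i : Fin 2) :
    (((c * (k i).val + r i : ℕ) : ZMod (M * c))).val = c * (k i).val + r i := by
  rw [ZMod.val_natCast, Nat.mod_eq_of_lt]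
  have hk : (k i).val < M := ZMod.val_lt _
  have hr : (r i : ℕ) < c := (r i).isLt
  calc c * (k i).val + r i < c * (k i).val + c := by omega
    _ = c * ((k i).val + 1) := by ring
    _ ≤ c * M := Nat.mul_le_mul_left c hk
    _ = M * c := Nat.mul_comm _ _

/-- The refinement map is a bijection `(ℤ/Mℤ)² × [0,c)² → (ℤ/(Mc)ℤ)²`. [folklore] -/
theorem torusSite_refine_bijective (M c : ℕ) [NeZero M] [NeZero c] :
    Function.Bijective (fun p : TorusSite 2 M × (Fin 2 → Fin c) =>
      fun i => ((c * (p.1 i).val + p.2 i : ℕ) : ZMod (M * c))) := by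
  have hc : 0 < c := Nat.pos_of_ne_zero (NeZero.ne c)
  rw [Fintype.bijective_iff_injective_and_card]
  refine ⟨?_, ?_⟩
  · rintro ⟨k, r⟩ ⟨k', r'⟩ h
    have hi : ∀ i, c * (k i).val + r i = c * (k' i).val + r' i := by
      intro i
      have h1 := congrArg (fun f : TorusSite 2 (M * c) => (f i).val) h
      simpa only [torusSite_refine_val M c] using h1
    have hkr : ∀ i, (k i).val = (k' i).val ∧ (r i : ℕ) = r' i := by
      intro i
      have h1 := hi i
      have hr : (r i : ℕ) < c := (r i).isLt
      have hr' : (r' i : ℕ) < c := (r' i).isLt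
      have hdiv : (c * (k i).val + r i) / c = (c * (k' i).val + r' i) / c := by rw [h1]
      rw [Nat.mul_add_div hc, Nat.mul_add_div hc, Nat.div_eq_of_lt hr,
        Nat.div_eq_of_lt hr'] at hdiv
      simp only [add_zero] at hdiv
      refine ⟨hdiv, ?_⟩
      rw [hdiv] at h1
      omega
    refine Prod.ext ?_ ?_
    · funext i
      exact ZMod.val_injective _ (hkr i).1
    · funext i
      exact Fin.ext (hkr i).2
  · simp only [Fintype.card_prod, Fintype.card_fun, ZMod.card, Fintype.card_fin]
    ring

/-- Along the refinement map the band moves by at most `8π/M`: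
`|ε_{Mc}(c·k + r) - ε_M(k)| ≤ 8π/M`. [folklore] -/
theorem abs_torusBand_refine_sub_le (M c : ℕ) [NeZero M] [NeZero c] (k : TorusSite 2 M)
    (r : Fin 2 → Fin c) :
    |torusBand (M * c) (fun i => ((c * (k i).val + r i : ℕ) : ZMod (M * c))) - torusBand M k| ≤
      8 * Real.pi / M := by
  have hc : 0 < c := Nat.pos_of_ne_zero (NeZero.ne c)
  have hM : (0 : ℝ) < M := Nat.cast_pos.2 (Nat.pos_of_ne_zero (NeZero.ne M))
  have hcpos : (0 : ℝ) < c := Nat.cast_pos.2 hc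
  unfold torusBand
  rw [show -2 * ∑ i, Real.cos (latticeMomentum (M * c)
      (fun i => ((c * (k i).val + r i : ℕ) : ZMod (M * c))) i) -
      -2 * ∑ i, Real.cos (latticeMomentum M k i) =
      -2 * ∑ i, (Real.cos (latticeMomentum (M * c)
        (fun i => ((c * (k i).val + r i : ℕ) : ZMod (M * c))) i) -
        Real.cos (latticeMomentum M k i)) by rw [Finset.sum_sub_distrib]; ring]
  rw [abs_mul, abs_neg, abs_two]
  have hterm : ∀ i : Fin 2, |Real.cos (latticeMomentum (M * c)
      (fun i => ((c * (k i).val + r i : ℕ) : ZMod (M * c))) i) -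
        Real.cos (latticeMomentum M k i)| ≤ 2 * Real.pi / M := by
    intro i
    refine (Real.abs_cos_sub_cos_le _ _).trans ?_
    simp only [latticeMomentum, torusSite_refine_val M c]
    have hr : ((r i : ℕ) : ℝ) < c := by exact_mod_cast (r i).isLt
    have hr0 : (0 : ℝ) ≤ ((r i : ℕ) : ℝ) := Nat.cast_nonneg _
    rw [show 2 * Real.pi * ((c * (k i).val + (r i : ℕ) : ℕ) : ℝ) / ((M * c : ℕ) : ℝ) -
        2 * Real.pi * ((k i).val : ℝ) / (M : ℝ) =
        2 * Real.pi * ((r i : ℕ) : ℝ) / ((M : ℝ) * c) by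
      push_cast
      field_simp
      ring]
    rw [abs_of_nonneg (by positivity), div_le_div_iff₀ (by positivity) hM]
    calc 2 * Real.pi * ((r i : ℕ) : ℝ) * M ≤ 2 * Real.pi * c * M := by
          gcongr
      _ = 2 * Real.pi * (M * c) := by ring
  calc 2 * |∑ i, (Real.cos (latticeMomentum (M * c)
        (fun i => ((c * (k i).val + r i : ℕ) : ZMod (M * c))) i) -
          Real.cos (latticeMomentum M k i))|
      ≤ 2 * ∑ i : Fin 2, 2 * Real.pi / M := by
        gcongr
        exact (Finset.abs_sum_le_sum_abs _ _).trans (Finset.sum_le_sum fun i _ => hterm i)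
    _ = 8 * Real.pi / M := by
        simp only [Finset.sum_const, Finset.card_univ, Fintype.card_fin, nsmul_eq_mul]
        push_cast
        ring

/-! ### The refinement comparison of the grand-canonical band sums -/

/-- `t ↦ min(t - μ, 0)` is `1`-Lipschitz. [folklore] -/
theorem abs_min_sub_zero_sub_min_sub_zero_le (a b μ : ℝ) :
    |min (a - μ) 0 - min (b - μ) 0| ≤ |a - b| := by
  have h := abs_min_sub_min_le_max (a - μ) 0 (b - μ) 0
  rw [sub_self, abs_zero] at h
  refine h.trans ?_
  rw [max_le_iff]
  refine ⟨le_of_eq ?_, abs_nonneg _⟩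
  congr 1
  ring

/-- **Refinement comparison**: `|c² · G_M(μ) - G_{Mc}(μ)| ≤ 8π · M · c²`, where
`G_L(μ) = Σ_{k ∈ (ℤ/Lℤ)²} min(ε_L(k) - μ, 0)`. [folklore] -/
theorem abs_sq_mul_gcBandSum_sub_le (M c : ℕ) [NeZero M] [NeZero c] (μ : ℝ) :
    |(c : ℝ) ^ 2 * ∑ k : TorusSite 2 M, min (torusBand M k - μ) 0 -
        ∑ k' : TorusSite 2 (M * c), min (torusBand (M * c) k' - μ) 0| ≤
      8 * Real.pi * M * (c : ℝ) ^ 2 := by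
  have hM : (0 : ℝ) < M := Nat.cast_pos.2 (Nat.pos_of_ne_zero (NeZero.ne M))
  -- reindex the fine sum through the refinement bijection
  have hre : ∑ k' : TorusSite 2 (M * c), min (torusBand (M * c) k' - μ) 0 =
      ∑ p : TorusSite 2 M × (Fin 2 → Fin c),
        min (torusBand (M * c) (fun i => ((c * (p.1 i).val + p.2 i : ℕ) : ZMod (M * c))) - μ) 0 :=
    (Fintype.sum_bijective _ (torusSite_refine_bijective M c) _ _ fun p => rfl).symm
  -- the coarse sum, counted `c²` times
  have hco : (c : ℝ) ^ 2 * ∑ k : TorusSite 2 M, min (torusBand M k - μ) 0 =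
      ∑ p : TorusSite 2 M × (Fin 2 → Fin c), min (torusBand M p.1 - μ) 0 := by
    rw [Fintype.sum_prod_type]
    simp only [Finset.sum_const, Finset.card_univ, Fintype.card_fun, Fintype.card_fin,
      nsmul_eq_mul, Finset.mul_sum]
    refine Finset.sum_congr rfl fun k _ => ?_
    push_cast
    ring
  rw [hre, hco, ← Finset.sum_sub_distrib]
  calc |∑ p : TorusSite 2 M × (Fin 2 → Fin c), (min (torusBand M p.1 - μ) 0 -
        min (torusBand (M * c) (fun i => ((c * (p.1 i).val + p.2 i : ℕ) : ZMod (M * c))) - μ) 0)|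
      ≤ ∑ p : TorusSite 2 M × (Fin 2 → Fin c), |min (torusBand M p.1 - μ) 0 -
        min (torusBand (M * c) (fun i => ((c * (p.1 i).val + p.2 i : ℕ) : ZMod (M * c))) - μ) 0| :=
        Finset.abs_sum_le_sum_abs _ _
    _ ≤ ∑ _p : TorusSite 2 M × (Fin 2 → Fin c), 8 * Real.pi / M := by
        refine Finset.sum_le_sum fun p _ => ?_
        refine (abs_min_sub_zero_sub_min_sub_zero_le _ _ _).trans ?_
        rw [abs_sub_comm]
        exact abs_torusBand_refine_sub_le M c p.1 p.2
    _ = 8 * Real.pi * M * (c : ℝ) ^ 2 := by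
        simp only [Finset.sum_const, Finset.card_univ, Fintype.card_prod, Fintype.card_fun,
          ZMod.card, Fintype.card_fin, nsmul_eq_mul]
        push_cast
        field_simp

/-- The grand-canonical band sum depends only on the side (transport along `a = b`). [folklore] -/
theorem gcBandSum_congr {a b : ℕ} [NeZero a] [NeZero b] (h : a = b) (μ : ℝ) :
    ∑ k : TorusSite 2 a, min (torusBand a k - μ) 0 = ∑ k : TorusSite 2 b, min (torusBand b k - μ) 0 := by
  subst h
  rfl

/-- **Two grids compared through their common refinement**: for `L, L' ≥ 1`,
`G_{L'}(μ)/L'² ≥ G_L(μ)/L² - 8π/L - 8π/L'`, uniformly in `μ`. [folklore] -/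
theorem gcBandSum_div_sq_ge_of_refine (L L' : ℕ) [NeZero L] [NeZero L'] (μ : ℝ) :
    (∑ k : TorusSite 2 L, min (torusBand L k - μ) 0) / (L : ℝ) ^ 2 -
        8 * Real.pi / L - 8 * Real.pi / L' ≤
      (∑ k : TorusSite 2 L', min (torusBand L' k - μ) 0) / (L' : ℝ) ^ 2 := by
  have hL : (0 : ℝ) < L := Nat.cast_pos.2 (Nat.pos_of_ne_zero (NeZero.ne L))
  have hL' : (0 : ℝ) < L' := Nat.cast_pos.2 (Nat.pos_of_ne_zero (NeZero.ne L'))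
  have h1 := abs_sq_mul_gcBandSum_sub_le L L' μ
  have h2 := abs_sq_mul_gcBandSum_sub_le L' L μ
  -- the two refinements are the same torus
  rw [gcBandSum_congr (Nat.mul_comm L' L) μ] at h2
  set F := ∑ k' : TorusSite 2 (L * L'), min (torusBand (L * L') k' - μ) 0 with hF
  set A := ∑ k : TorusSite 2 L, min (torusBand L k - μ) 0 with hA
  set B := ∑ k : TorusSite 2 L', min (torusBand L' k - μ) 0 with hB
  have h1' := (abs_le.1 h1).2   -- L'² A - F ≤ 8π L L'²
  have h2' := (abs_le.1 h2).1   -- -(8π L' L²) ≤ L² B - F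
  have key : A * (L' : ℝ) ^ 2 - 8 * Real.pi * L * (L' : ℝ) ^ 2 - 8 * Real.pi * L' * (L : ℝ) ^ 2 ≤
      B * (L : ℝ) ^ 2 := by linarith
  have hden : (0 : ℝ) < (L : ℝ) ^ 2 * (L' : ℝ) ^ 2 := by positivity
  calc A / (L : ℝ) ^ 2 - 8 * Real.pi / L - 8 * Real.pi / L'
      = (A * (L' : ℝ) ^ 2 - 8 * Real.pi * L * (L' : ℝ) ^ 2 - 8 * Real.pi * L' * (L : ℝ) ^ 2) /
          ((L : ℝ) ^ 2 * (L' : ℝ) ^ 2) := by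
        field_simp
    _ ≤ B * (L : ℝ) ^ 2 / ((L : ℝ) ^ 2 * (L' : ℝ) ^ 2) := div_le_div_of_nonneg_right key hden.le
    _ = B / (L' : ℝ) ^ 2 := by
        field_simp

end

end Literature.MathematicalPhysics.QuantumLattice
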